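/-
Copyright: statement-level skeleton of a published paper (lit-balaban cell, Phase-2 proof seat p13, gen 9; v1.1 DOCFIX gen 11:
the p. 290 quotation in the header corrected to the print's "inserted into F_{1,j}, yielding" (ref-1 F4-NIT); every declaration
byte-identical to v1 p308569). No proof claims beyond what the kernel checks below.
-/
import Literature.MathematicalPhysics.QuantumFieldTheory.BalabanImbrieJaffe1984to88.BIJ88WSplit290
import Literature.MathematicalPhysics.QuantumFieldTheory.BalabanImbrieJaffe1984to88.BIJ88F1Expansion577

/-!
# `BalabanImbrieJaffe1984to88.BIJ88WSplit290Inputs` — T. Bałaban, J. Imbrie, A. Jaffe, *Effective action and cluster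
properties of the abelian Higgs model*, Commun. Math. Phys. **114** (1988) 257–315 [BalabanImbrieJaffe1988]: Sect. 5.7,
p. 290 — THE CHAIN ASSEMBLED: the inputs of the `W^{(j)}` split (file 3 `BIJ88WSplit290.Hyps`: positive order, rootedness and
the two sizes of the entry expansions of `V_j`) PRODUCED from the (5.7.7) vertex data (file 2a/2b: `V_j(y,y′) = Σ_k c_k F_k F′_k`
with expanded factors), and from the expansion of `F_{1,j}` of the first p. 290 display (file 4 `glF1`): *"These expansions can be
inserted into F_{1,j}, yielding [(5.7.7)] […] We insert the expansion for V_j into this formula"* end to end, so that the kernel bound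
*"|W^{(j)}(X; x₁, x₂)| ≦ e_j^{n̄+1−α}e^{−cr(e_k)|X|⁻}"* holds with inputs = propagator entries, local coefficients, and per factor
the p. 290 data (local part, kernel row, field, association) under (5.7.6) and the field bounds (file 6 of seat p13 gen 9).

statement-level skeleton of published theorems with citation tags; proofs where landed; nothing here is a claim about the Yang–Mills mass gap

PDF held: `paper:balaban1988-cmp114-bij-abelian-higgs-effective-action` (journal page = PDF page + 256); pp. 289–291
[PDF 33–35] read as IMAGES (CCITT renders; copies `HOME/lit-balaban-p13/pages/`).

CITATION HEADER (lean-in-tree rule).  Part of the lit-balaban TYPED SKELETON (HOME `run/shared/lean/pub/lit-balaban/`):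
WHAT IS REPRODUCED = row **C2.Eq5.7.7-5.7.9** of `HOME/lit-balaban-r16/ROWS-C2-part2.md`, member (5.7.7) — assembly of files
1a/2a/2b/3/4.  Unit `lit-balaban-p13` (gen 9), owner r16, referee ref-5.  Built BY NAME on `vertexExp`, `vertexExp_rooted`,
`lowNormW_vertexExp_le`, `actNorm_vertexExp_le`, `mul_low_zero` (2a/2b), `Hyps`, `norm_wExp_act_le` (3), `glF1`, `glF1_rooted`,
`glF1_low_zero`, `lowNormW_glF1_le`, `actNorm_glF1_le` (4); nothing restated.

## What is kernel-checked here

* `vertexExp_low_zero` — `V_j` has positive order when its first factors do.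
* **`hyps_of_vertex`** — file 3's `Hyps` for `V y y′ := vertexExp (c y y′) (E y y′) (E′ y y′)` from uniform factor bounds
  (`lowNormW ρ ≤ L`, `actNorm κ ≤ δ`, rooted, positive order), coefficient bounds `Σ_k ‖c_k(y,y′)‖ ≤ C`, propagator bounds, and the
  convergence condition; the row sums over the cube `□(x₁,x₂)` contribute its site number `|T|` (the print's volume factor
  `(r(e_k)L^{k−j})^d` of (5.7.9)): `ℓ = |T|·C·L²`, `a = |T|·C·(qL² + 2Lδ + δ²)`.
* **`norm_wAct_le_of_vertex`** — the kernel bound of `W^{(j)}(X; x₁, x₂)` with these inputs.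
* **`hyps_of_F1`** — the same with every factor the expansion `glF1` of an `F_{1,j}`-type quantity (file 4): `L ≥ ρRe^{ρζR}`,
  `δ ≥ 2δ₀` (`δ₀` the constant of 1a's `norm_F1loc_le`), rootedness/connectedness from the association, under (5.7.6) (shape, every
  `m ≥ 1`), the field bounds and the lattice-animal condition `(Δ+1)²e^{−(κ−κ′)} ≤ ½`.

HONEST SCOPE as in files 1a–5 (model level; `F_{2,j}`-type factors enter `hyps_of_vertex` through their own bounds, cf. 1b).
Theorems only; no `Prop` facts; axioms standard.
-/

noncomputable section

open scoped BigOperators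
open Finset

namespace Literature.MathematicalPhysics.QuantumFieldTheory.BalabanImbrieJaffe1984to88.BIJ88WSplit290Inputs

open BIJ88TraceTerms579 (cubePolymers)
open BIJ88Sect5StatementsPart2 (PolymerSys)
open BIJ88F1Localized290 (wloc LocDatum)
open BIJ88Expansion577 BIJ88Expansion577.GLExp BIJ88Expansion577Bounds BIJ88WSplit290 BIJ88F1Expansion577
open Literature.Probability.LatticeModels (IsRConnected)

variable {ι : Type} [Fintype ι] [DecidableEq ι] {T : Type*} [Fintype T] {K : Type*} [Fintype K]
  (nbar : ℕ) (ε : ℝ) (c₀ : ι)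

/-- `V_j` has positive order (`low 0 = 0`) when every first factor has (*"Each term … has at least one factor e_j"*).
[cite: BalabanImbrieJaffe1988, (5.7.7) p.290] -/
theorem vertexExp_low_zero {c : K → ℂ} {E E' : K → GLExp ι} (h0 : ∀ k, (E k).low 0 = 0) :
    (vertexExp nbar ε c₀ c E E').low 0 = 0 := by
  show ∑ k, c k * (GLExp.mul nbar ε c₀ (E k) (E' k)).low 0 = 0
  exact Finset.sum_eq_zero fun k _ => by rw [GLExp.mul_low_zero nbar ε c₀ (h0 k), mul_zero]

/-- **THE INPUTS OF THE `W^{(j)}` SPLIT FROM THE (5.7.7) VERTEX DATA**: for `V_j(y,y′) = Σ_k c_k(y,y′)F_kF′_k` with factor expansions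
rooted at `c₀`, first factors of positive order, uniform sizes `lowNormW ρ ≤ L`, `actNorm κ ≤ δ` (`L, δ ≥ 0`), coefficients
`Σ_k‖c_k(y,y′)‖ ≤ C`, propagator entries `‖G(x,y)‖ ≤ γ`, `Σ_y‖G(x,y)‖ ≤ g`, and `θ = g(ℓ + a) < 1` with `ℓ = |T|CL²`,
`a = |T|C(qL² + Lδ + δL + δ²)` (`q = (|e_j|/ρ)^{n̄+1}`; `|T|` = the number of sites of `□(x₁,x₂)`, the volume factor of (5.7.9)),
file 3's hypotheses hold. [cite: BalabanImbrieJaffe1988, (5.7.7) p.290] -/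
theorem hyps_of_vertex (G : T → T → ℂ) (c : T → T → K → ℂ) (E E' : T → T → K → GLExp ι) {ρ κ γ g L δ C : ℝ}
    (hρ : 0 < ρ) (hερ : |ε| ≤ ρ) (hκ : 0 ≤ κ) (hL0 : 0 ≤ L) (hδ0 : 0 ≤ δ)
    (hE : ∀ y y' k, Rooted c₀ (E y y' k)) (hE' : ∀ y y' k, Rooted c₀ (E' y y' k)) (h0 : ∀ y y' k, (E y y' k).low 0 = 0)
    (hL : ∀ y y' k, lowNormW ρ nbar (E y y' k) ≤ L) (hL' : ∀ y y' k, lowNormW ρ nbar (E' y y' k) ≤ L)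
    (hδ : ∀ y y' k, (E y y' k).actNorm κ ≤ δ) (hδ' : ∀ y y' k, (E' y y' k).actNorm κ ≤ δ)
    (hC : ∀ y y', ∑ k, ‖c y y' k‖ ≤ C) (hγ : ∀ x y, ‖G x y‖ ≤ γ) (hg : ∀ x, ∑ y, ‖G x y‖ ≤ g)
    (hθ : g * (Fintype.card T * (C * (L * L)) +
      Fintype.card T * (C * ((|ε| / ρ) ^ (nbar + 1) * (L * L) + L * δ + δ * L + δ * δ))) < 1) :
    Hyps nbar ε c₀ G (fun y y' => vertexExp nbar ε c₀ (c y y') (E y y') (E' y y')) ρ κ γ g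
      (Fintype.card T * (C * (L * L)))
      (Fintype.card T * (C * ((|ε| / ρ) ^ (nbar + 1) * (L * L) + L * δ + δ * L + δ * δ))) where
  hρ := hρ
  hερ := hερ
  hκ := hκ
  rooted y y' := vertexExp_rooted nbar ε c₀ (hE y y') (hE' y y')
  posOrder y y' := vertexExp_low_zero nbar ε c₀ (h0 y y')
  hγ := hγ
  hg := hg
  hℓ y := by
    calc ∑ y', lowNormW ρ nbar (vertexExp nbar ε c₀ (c y y') (E y y') (E' y y'))
        ≤ ∑ _y' : T, C * (L * L) := Finset.sum_le_sum fun y' _ =>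
          (lowNormW_vertexExp_le nbar ε c₀ hρ.le (L := fun _ => L) (L' := fun _ => L) (hL y y') (hL' y y')).trans (by
            rw [← Finset.sum_mul]
            exact mul_le_mul_of_nonneg_right (hC y y') (mul_nonneg hL0 hL0))
      _ = Fintype.card T * (C * (L * L)) := by rw [Finset.sum_const, nsmul_eq_mul, Finset.card_univ]
  ha y := by
    have hq0 : 0 ≤ (|ε| / ρ) ^ (nbar + 1) := pow_nonneg (div_nonneg (abs_nonneg _) hρ.le) _
    calc ∑ y', (vertexExp nbar ε c₀ (c y y') (E y y') (E' y y')).actNorm κ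
        ≤ ∑ _y' : T, C * ((|ε| / ρ) ^ (nbar + 1) * (L * L) + L * δ + δ * L + δ * δ) :=
          Finset.sum_le_sum fun y' _ =>
            (actNorm_vertexExp_le nbar c₀ hρ hερ hκ (hE y y') (hE' y y') (L := fun _ => L) (L' := fun _ => L)
              (δ := fun _ => δ) (δ' := fun _ => δ) (hL y y') (hL' y y') (hδ y y') (hδ' y y')).trans (by
              rw [← Finset.sum_mul]
              exact mul_le_mul_of_nonneg_right (hC y y') (by positivity))
      _ = Fintype.card T * (C * ((|ε| / ρ) ^ (nbar + 1) * (L * L) + L * δ + δ * L + δ * δ)) := by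
          rw [Finset.sum_const, nsmul_eq_mul, Finset.card_univ]
  hθ := hθ

/-- **THE KERNEL BOUND OF `W^{(j)}(X; x₁, x₂)` WITH THE VERTEX INPUTS** (file 3's `norm_wExp_act_le` under `hyps_of_vertex`):
`‖W^{(j)}(X; x₁, x₂)‖ ≤ γg(qℓ + a)/(1−g(ℓ+a))²·e^{−κ|X|⁻}`, `ℓ = |T|CL²`, `a = |T|C(qL² + Lδ + δL + δ²)`.
[cite: BalabanImbrieJaffe1988, (5.7.7) p.290] -/
theorem norm_wAct_le_of_vertex [Nonempty T] (G : T → T → ℂ) (c : T → T → K → ℂ) (E E' : T → T → K → GLExp ι)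
    {ρ κ γ g L δ C : ℝ} (hρ : 0 < ρ) (hερ : |ε| ≤ ρ) (hκ : 0 ≤ κ) (hL0 : 0 ≤ L) (hδ0 : 0 ≤ δ)
    (hE : ∀ y y' k, Rooted c₀ (E y y' k)) (hE' : ∀ y y' k, Rooted c₀ (E' y y' k)) (h0 : ∀ y y' k, (E y y' k).low 0 = 0)
    (hL : ∀ y y' k, lowNormW ρ nbar (E y y' k) ≤ L) (hL' : ∀ y y' k, lowNormW ρ nbar (E' y y' k) ≤ L)
    (hδ : ∀ y y' k, (E y y' k).actNorm κ ≤ δ) (hδ' : ∀ y y' k, (E' y y' k).actNorm κ ≤ δ)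
    (hC : ∀ y y', ∑ k, ‖c y y' k‖ ≤ C) (hγ : ∀ x y, ‖G x y‖ ≤ γ) (hg : ∀ x, ∑ y, ‖G x y‖ ≤ g)
    (hθ : g * (Fintype.card T * (C * (L * L)) +
      Fintype.card T * (C * ((|ε| / ρ) ^ (nbar + 1) * (L * L) + L * δ + δ * L + δ * δ))) < 1)
    (x₁ x₂ : T) (X : Finset ι) :
    ‖(wExp nbar ε c₀ G (fun y y' => vertexExp nbar ε c₀ (c y y') (E y y') (E' y y')) x₁ x₂).act X‖ ≤
      γ * (g * ((|ε| / ρ) ^ (nbar + 1) * (Fintype.card T * (C * (L * L))) +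
        Fintype.card T * (C * ((|ε| / ρ) ^ (nbar + 1) * (L * L) + L * δ + δ * L + δ * δ)))) /
        (1 - g * (Fintype.card T * (C * (L * L)) +
          Fintype.card T * (C * ((|ε| / ρ) ^ (nbar + 1) * (L * L) + L * δ + δ * L + δ * δ)))) ^ 2 *
        Real.exp (-κ * (cubePolymers ι).cardMinus X) :=
  (hyps_of_vertex nbar ε c₀ G c E E' hρ hερ hκ hL0 hδ0 hE hE' h0 hL hL' hδ hδ' hC hγ hg hθ).norm_wExp_act_le x₁ x₂ X

/-! ## Every factor an `F_{1,j}`-type expansion (file 4) -/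

/-- **THE CHAIN FROM THE p. 290 DATA**: with every factor the expansion `glF1` of an `F_{1,j}`-type quantity — data `D y y′ k`
(local part, kernel row `w₅(b,·)`, field `A′`, association), field size `radius ≤ R`, (5.7.6) in the shape `|w_{b,m}(X)| ≤
M^m e^{−κ|X|}` for every `m ≥ 1`, `|a_loc| ≤ p`, the empty collection on one cube, associations rooted at `c₀` and `R`-connected,
and the lattice-animal condition `(Δ+1)²e^{−(κ−κ′)} ≤ ½` — file 3's hypotheses hold at the rate `κ′` for any sizes
`L ≥ ρRe^{ρζR}`, `δ ≥ 2δ₀` (`δ₀ = ζ^{n̄}(e_j(p+M))^{n̄+1}e^{e_jζ(p+M)}/(n̄+1)!`, the constant of 1a's `norm_F1loc_le`).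
[cite: BalabanImbrieJaffe1988, (5.7.7) p.290] -/
theorem hyps_of_F1 {β : Type*} [Fintype β] (G : T → T → ℂ) (c : T → T → K → ℂ)
    (D D' : T → T → K → LocDatum β (Finset ι)) (ej ζ : ℝ) {ρ κ κ' γ g C R p M : ℝ}
    {Radj : ι → ι → Prop} (hRs : ∀ x y, Radj x y → Radj y x) {nbr : ι → Finset ι} {Δ : ℕ}
    (hΔ : ∀ x, (nbr x).card ≤ Δ) (hnbr : ∀ x y, Radj x y → y ∈ nbr x)
    (hρ : 0 < ρ) (hερ : |ej| ≤ ρ) (hej : 0 ≤ ej) (hζ : 0 < ζ) (hp : 0 ≤ p) (hM : 0 ≤ M) (hκ : 0 ≤ κ) (hκ' : 0 ≤ κ')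
    (hsmall : ((Δ : ℝ) + 1) ^ 2 * Real.exp (-(κ - κ')) ≤ 1 / 2)
    (hroot : ∀ y y' k m (t : Fin m → β), c₀ ∈ (D y y' k).assoc m t ∧ c₀ ∈ (D' y y' k).assoc m t)
    (hconn : ∀ y y' k m (t : Fin m → β), IsRConnected Radj ((D y y' k).assoc m t) ∧ IsRConnected Radj ((D' y y' k).assoc m t))
    (hR : ∀ y y' k, (D y y' k).radius ≤ R ∧ (D' y y' k).radius ≤ R)
    (hpD : ∀ y y' k, |(D y y' k).aloc| ≤ p ∧ |(D' y y' k).aloc| ≤ p)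
    (h576 : ∀ y y' k m, 1 ≤ m → ∀ X,
      |wloc (D y y' k).wr (D y y' k).A' m ((D y y' k).assoc m) X| ≤ M ^ m * Real.exp (-κ * (cubePolymers ι).card X) ∧
      |wloc (D' y y' k).wr (D' y y' k).A' m ((D' y y' k).assoc m) X| ≤ M ^ m * Real.exp (-κ * (cubePolymers ι).card X))
    (h0 : ∀ y y' k (t : Fin 0 → β),
      (cubePolymers ι).card ((D y y' k).assoc 0 t) ≤ 1 ∧ (cubePolymers ι).card ((D' y y' k).assoc 0 t) ≤ 1)
    (hC : ∀ y y', ∑ k, ‖c y y' k‖ ≤ C) (hγ : ∀ x y, ‖G x y‖ ≤ γ) (hg : ∀ x, ∑ y, ‖G x y‖ ≤ g)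
    (hR0 : 0 ≤ R) {L δ : ℝ} (hLdef : ρ * R * Real.exp (ρ * ζ * R) ≤ L)
    (hδdef : 2 * (ζ ^ nbar * (ej * (p + M)) ^ (nbar + 1) / ((nbar + 1).factorial : ℝ) * Real.exp (ej * ζ * (p + M))) ≤ δ)
    (hθ : g * (Fintype.card T * (C * (L * L)) +
      Fintype.card T * (C * ((|ej| / ρ) ^ (nbar + 1) * (L * L) + L * δ + δ * L + δ * δ))) < 1) :
    Hyps nbar ej c₀ G
      (fun y y' => vertexExp nbar ej c₀ (c y y') (fun k => glF1 (D y y' k) ej ζ nbar) (fun k => glF1 (D' y y' k) ej ζ nbar))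
      ρ κ' γ g (Fintype.card T * (C * (L * L)))
      (Fintype.card T * (C * ((|ej| / ρ) ^ (nbar + 1) * (L * L) + L * δ + δ * L + δ * δ))) := by
  have hL0 : 0 ≤ L := le_trans (by positivity) hLdef
  have hδ0 : 0 ≤ δ := le_trans (by positivity) hδdef
  exact hyps_of_vertex nbar ej c₀ G c _ _ hρ hερ hκ' hL0 hδ0
    (fun y y' k => glF1_rooted (D y y' k) ej ζ nbar fun m t => (hroot y y' k m t).1)
    (fun y y' k => glF1_rooted (D' y y' k) ej ζ nbar fun m t => (hroot y y' k m t).2)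
    (fun y y' k => glF1_low_zero (D y y' k) ej ζ nbar)
    (fun y y' k => (lowNormW_glF1_le (D y y' k) ej ζ nbar hζ hρ.le (hR y y' k).1).trans hLdef)
    (fun y y' k => (lowNormW_glF1_le (D' y y' k) ej ζ nbar hζ hρ.le (hR y y' k).2).trans hLdef)
    (fun y y' k => (actNorm_glF1_le (D y y' k) ej ζ nbar hRs hΔ hnbr (fun m t => (hroot y y' k m t).1)
      (fun m t => (hconn y y' k m t).1) hej hζ (hpD y y' k).1 hM hκ (fun m hm X => (h576 y y' k m hm X).1)
      (fun t => (h0 y y' k t).1) hsmall).trans hδdef)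
    (fun y y' k => (actNorm_glF1_le (D' y y' k) ej ζ nbar hRs hΔ hnbr (fun m t => (hroot y y' k m t).2)
      (fun m t => (hconn y y' k m t).2) hej hζ (hpD y y' k).2 hM hκ (fun m hm X => (h576 y y' k m hm X).2)
      (fun t => (h0 y y' k t).2) hsmall).trans hδdef)
    hC hγ hg hθ

end Literature.MathematicalPhysics.QuantumFieldTheory.BalabanImbrieJaffe1984to88.BIJ88WSplit290Inputs

end
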